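import Literature.MathematicalPhysics.QuantumFieldTheory.Balaban1983to89.B1Eq323SetPartitions
import Literature.MathematicalPhysics.QuantumFieldTheory.Balaban1983to89.B1Eq324CumulantTaylor

/-!
# `Balaban1983to89.B1Eq324WeightedCumulantLeaf` — T. Bałaban, *(Higgs)₂,₃ quantum fields in a finite volume. I. A lower bound*,
Commun. Math. Phys. **85** (1982) 603–626 [Balaban1982Higgs1], (3.24) p. 616 and (3.59) p. 623: **LEAF (b) OF THE CUMULANT
EXPANSION «TAKING INTO ACCOUNT THE EXISTENCE OF THE CHARACTERISTIC FUNCTIONS» — THE CUMULANTS OF THE χ-WEIGHTED LAW VERSUS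
PRINT'S UNWEIGHTED CUMULANTS `⟨Vⁿ⟩ᵀ`, REDUCED TO THE TAIL `⟨1 − χ⟩` AND `L²`-MOMENT BOUNDS OF `V`** — theorems + two definitions
with bodies (explicit constants); no `Prop`-valued fact

statement-level skeleton of published theorems with citation tags; proofs where landed; nothing here is a claim about the Yang–Mills mass gap

PDF held: `paper:balaban1982-cmp85-higgs23-i` (journal page = PDF page + 602); pp. 616, 617, 623 [PDF 14, 15, 21] re-read this session
in the materialised text `~/.lit/texts/paper-balaban1982-cmp85-higgs23-i/p0014.txt`, `p0015.txt`, `p0021.txt` (the quotations below were checked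
against it; the displays themselves are quoted from the header of `B1Eq324CumulantTaylor`, whose author read the ×2 render).

CITATION HEADER (lean-in-tree rule).  lit-balaban typed skeleton (HOME `run/shared/lean/pub/lit-balaban/`), unit `lit-balaban-r14`
gen 25 (B1 fold owner `literature-prover-lit-balaban-r14-g25-0`; TAKING line HOME/STATUS.md 2026-08-24T17:36:45Z, free-target protocol
G.5-34 (d)).  SKELETON rows **B1.Eq3.24** / **B1.Eq3.59** (rows of record r12 `lit-balaban-r12/ROWS-B1-part2.md`, both `typed`:
*"DISCHARGED MODULO NAMED LEAVES"* — p27's `B1Eq324CumulantTaylor.eq324_chi` / `cumulant359_of_leaves` derive the display from three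
inputs (a) `|log⟨χ⟩| ≤ C₁ε^κ|T₁|` (retired on the carrier by r14's `B1Eq324SmallFieldLeaf`), (b) THE CUMULANTS WRITTEN ON THE RIGHT
OF (3.24) VERSUS THOSE OF THE χ-WEIGHTED LAW, (c) the order-`n̄+1` remainder = "the lemma on p. 152 of [2]").  THIS FILE TREATS
LEAF (b): it is reduced to the tail `⟨1 − χ⟩` (leaf-(a) data) and to `L²(μ)`-bounds on the powers `Vᵏ`, `k ≤ n̄`, of the
polynomial `V` under the UNWEIGHTED law (Gaussian moments — a displayed input, not derived here).  No head change is claimed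
(leaf (c) stays external; source [2] NOT HELD, acquisition ids acq-09340 / acq-07983).  USED BY NAME, NOTHING RESTATED:
`B10Eq24Cumulant.nmoment` / `truncExp` / `chiMeasure` (the row-of-record objects of (3.23)–(3.24)),
`LatticeModels.cumulantOf` with its Möbius formula `cumulantOf_eq_sum_setPartitions` (the cumulants of a MOMENT SEQUENCE),
p36's `B1Eq323SetPartitions.truncExp_eq_cumulantOf_nmoment` (`⟨Vⁿ⟩ᵀ_ν = κₙ(⟨V^·⟩_ν)` for `V` bounded under `ν`), p27's
`B1Eq324CumulantTaylor.eq324_chi` / `Realization` / `cumulant359_of_leaves` (the knitting of §5–§6), r12's carriers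
`B1Sect3Statements.trunc2` / `trunc3` / `Eq324` and `B1LowerBound.C359Setting` / `Cumulant359`, and
Mathlib's Hölder inequality `MeasureTheory.integral_mul_le_Lp_mul_Lq_of_nonneg`.

THE SOURCE TEXT (verbatim, p. 616).  *"we use the cumulant expansion formula of the form ⟨exp(V)⟩ = exp[⟨V⟩ + (1/2!)⟨V²⟩^T +
(1/3!)⟨V³⟩^T + …], (3.23) where ⟨·⟩ denotes the expectation value with respect to the measure dμ_{C⁽⁰⁾}(A′)dμ_{C⁽⁰⁾(B⁽¹⁾)}(φ′),
V = V⁽⁰⁾ and ⟨Vⁿ⟩^T denotes the truncated expectation of a product of n polynomials V, thus ⟨V²⟩^T = ⟨V²⟩ − ⟨V⟩², ⟨V³⟩^T =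
⟨V³⟩ − 3⟨V²⟩⟨V⟩ + ⟨V⟩³* [sic] *, and so on. … The coefficients of the polynomial V are proportional to some positive powers of
ε. … we would like to have a cumulant expansion formula in the form taking into account the existence of the characteristic
functions also ⟨χ exp(V)⟩ = exp[⟨V⟩ + (1/2!)⟨V²⟩^T + … + (1/n̄!)⟨V^{n̄}⟩^T + O(ε^κ)|T₁|], κ > d. (3.24)"*; and after (3.25)
(p. 616 bottom – p. 617 top): *"The expression 𝒫^{(1),L} is a polynomial in ψ and its terms can be represented by suitable connected
graphs"* — i.e. the cumulants on the RIGHT of (3.24) are those of the UNWEIGHTED Gaussian law `⟨·⟩` (Wick graphs), while the LEFT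
carries `χ`.  At the general step, p. 623: *"Using the lemma we get* [the integral (3.56) `∫dμ_{C^{(k)}}(A′)∫dμ_{C^{(k)}(B^{(k+1)})}(φ′)
χ(A′)χ(φ′) exp V^{(k)}` =] *exp[Σ_{n=1}^{n̄} (1/n!)⟨(V^{(k)})ⁿ⟩^T + O(1)(L^kε)^κ|T₁^{(k)}|], κ > d. (3.59) … The terms of this
expansion are represented by the graphs which we get connecting the legs of the graphs representing V^{(k)} by the lines
corresponding to the suitable propagators"* (read in `p0021.txt`; the left side of (3.59) is OCR-garbled there and is supplied
in brackets from (3.56), cf. r14's `B1Eq356FluctuationIntegral`).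

THE READING OF `⟨Vⁿ⟩ᵀ` FOR THE UNWEIGHTED LAW.  Under the Gaussian measure the polynomial `V` is unbounded and `⟨e^{tV}⟩` need not
exist, so (3.23) is — as print says — *"a formal series"*: `⟨Vⁿ⟩ᵀ` is the solution of the moment–truncation relations «and so
on» in the MOMENTS `⟨Vᵏ⟩ = ∫Vᵏdμ` (which exist), i.e. `LatticeModels.cumulantOf (nmoment V μ) n`
(`CumulantRecursion.moment_succ_eq_sum_choose_mul_cumulantOf`; for a law under which `V` IS bounded this is the tree's `truncExp`,
`B1Eq323SetPartitions.truncExp_eq_cumulantOf_nmoment` / `trunc_eq_truncExp`).  §5 checks it against r12's printed carriers: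
`cumulantOf (nmoment V μ) 2 = trunc2 ⟨V⟩ ⟨V²⟩`, `cumulantOf (nmoment V μ) 3 = trunc3 ⟨V⟩ ⟨V²⟩ ⟨V³⟩`.

WHAT IS PROVED (0 `sorry`, standard axioms).
§1 GENERIC ALGEBRA.  `abs_prod_sub_prod_le` — finite products are Lipschitz on a box: `|Π a − Π b| ≤ |s|·R^{|s|}·δ` for
  `|aᵢ|,|bᵢ| ≤ R` (`R ≥ 1`), `|aᵢ − bᵢ| ≤ δ`; (private: a set partition of `W` has `≤ |W|` blocks); the EXPLICIT Lipschitz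
  constant **`cumLip n R := Σ_{π ∈ 𝒫([n])} (|π|−1)!·|π|·R^{|π|}`** of the moment → cumulant map and
  **`abs_cumulantOf_sub_cumulantOf_le`**: `|κₙ(m) − κₙ(m′)| ≤ cumLip n R · δ` whenever `|mₖ|,|m′ₖ| ≤ R`, `|mₖ − m′ₖ| ≤ δ`
  (`1 ≤ k ≤ n`; `m₀ = m′₀ = 1`) — from the Möbius formula `κₙ(m) = Σ_π (−1)^{|π|−1}(|π|−1)! Π_{P∈π} m_{|P|}`;
  `cumLip_nonneg`, `cumLip_mul_le` (`cumLip n (cM) ≤ Mⁿ·cumLip n c`, `M ≥ 1`); `cumulantOf_three`.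
§2 WEIGHTED CAUCHY–SCHWARZ.  `abs_integral_mul_le_sqrt_mul_sqrt` — `|∫ w g dμ| ≤ √(∫w dμ)·√(∫g² dμ)` for `0 ≤ w ≤ 1` (Hölder
  `p = q = 2` and `w² ≤ w`); `abs_integral_le_sqrt_integral_sq` (`|⟨g⟩| ≤ ‖g‖₂` on a probability space).
§3 TILTING BY χ (probability measure `μ`, measurable `0 ≤ χ ≤ 1`, `Z = ⟨χ⟩ > 0`, `τ = ⟨1 − χ⟩`): `nmoment_eq_integral`,
  `nmoment_chiMeasure` (`⟨Vᵏ⟩_{χμ} = ⟨χVᵏ⟩/⟨χ⟩`), `integral_chi_mul_sub` (`⟨χf⟩ − ⟨χ⟩⟨f⟩ = −⟨(1−χ)f⟩ + ⟨1−χ⟩⟨f⟩`) and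
  **`abs_nmoment_chiMeasure_sub_le`**: `|⟨Vᵏ⟩_{χμ} − ⟨Vᵏ⟩_μ| ≤ (√τ·‖Vᵏ‖₂ + τ·|⟨Vᵏ⟩|)/Z ≤ 2√τ‖Vᵏ‖₂/Z` (primed form).
§4 **LEAF (b)** `abs_sum_cumulantOf_sub_truncExp_le`: for `⟨χ⟩ ≥ ½` (i.e. tail `⟨1−χ⟩ ≤ ½`: r14's
  `B1Eq324SmallFieldLeaf.one_sub_integral_chiFluctA_le` / `…φ_le`, the same smallness that gives p27's `hpos` there), `V`
  μ-a.e.-measurable with `|V| ≤ B` on `{χ ≠ 0}` (p27's `hVB`), and `‖Vᵏ‖_{L²(μ)} ≤ M` (`1 ≤ k ≤ n̄`, `M ≥ 1`):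
  `|Σ_{n=1}^{n̄} (κₙ(⟨V^·⟩_μ) − ⟨Vⁿ⟩ᵀ_{χμ})/n!| ≤ leafBConst n̄ M · √⟨1 − χ⟩`, **`leafBConst n̄ M := 4M Σ_{n=1}^{n̄} cumLip n (5M)/n!`**
  (`leafBConst_nonneg`, `leafBConst_le_pow`: `≤ leafBConst n̄ 1 · M^{n̄+1}`).  Mechanism: per order `⟨Vⁿ⟩ᵀ_{χμ} = κₙ(⟨V^·⟩_{χμ})`
  (p36), the moments move by `≤ 4√τ M` (§3 with `Z ≥ ½`) inside the box `R = 5M`, and §1.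
  THE PRINTED FORM `abs_sum_cumulantOf_sub_truncExp_le_pow`: if `⟨1 − χ⟩ ≤ a·s^{2κ}·vol` (`vol ≥ 1`; leaf (a)'s union bound gives
  `⟨1 − χ⟩ ≤ 2d|T|s^K` for every `K`, `B1Eq324SmallFieldLeaf.one_sub_integral_chiFluctA_le` & co.) then
  `… ≤ (leafBConst n̄ M·√a)·s^κ·vol` — EXACTLY the hypothesis `hb` of p27's `eq324_chi` with `cum = cumulantOf (nmoment V μ)`;
  and `…_le_pow'`: with `M ≤ M₀ s^{−p}` (the moments of `V^{(k)}` grow with the number of sites) `… ≤ (leafBConst n̄ 1·M₀^{n̄+1}·√a)·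
  s^{κ − p(n̄+1)}·vol`, constants free of `s` — the (3.59)-uniform shape (`κ` is at our disposal since `K` is).
§5 KNITTING.  `cumulantOf_nmoment_two` / `cumulantOf_nmoment_three` (r12's `trunc2`/`trunc3` of the μ-moments ARE `κ₂`, `κ₃`);
  **`eq324_chi_gaussianCumulants`** — (3.24) VERBATIM WITH PRINT'S CUMULANTS ON THE RIGHT,
  `Eq324 ⟨χe^V⟩ (cumulantOf (nmoment V μ)) n̄ (C₁ + leafBConst n̄ M·√a + C₃) s κ vol`, from leaf (a) `ha`, leaf (c) `hc` (p27's
  shapes, untouched) and the moment data — p27's `eq324_chi` with `hb` DISCHARGED by §4.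
§6 THE k-TH STEP (3.59): `leafBConst_mono` and **`cumulant359_of_leaves_ac`** — r12's `B1LowerBound.Cumulant359 fam` from p27's
  `Realization` + leaves (a), (c) + moment data `‖(V^{(k)})ⁱ‖₂ ≤ M₀(L^kε)^{−p}`, tails `⟨1−χ⟩ ≤ a(L^kε)^{2(κ+p(n̄+1))}|T₁^{(k)}|`,
  `n̄ ≤ N`, the carrier writing print's cumulants (`trunc k n = κₙ(⟨(V^{(k)})^·⟩_μ)`): p27's `cumulant359_of_leaves` with `hb`
  DISCHARGED uniformly in the run and the step (constant `C₁ + leafBConst N 1·M₀^{N+1}·√a + C₃`).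
HONEST SCOPE.  (i) The `L²(μ)`-bounds `‖Vᵏ‖₂ ≤ M` (Gaussian moments of the polynomial `V`, print p. 616: *"The coefficients of the
polynomial V are proportional to some positive powers of ε"*) are HYPOTHESES here, as is the tail `⟨1 − χ⟩` (leaf (a) data, in the
tree for the concrete measures).  (ii) The constants `4`, `5`, `cumLip`, `leafBConst` are ours and immaterial; print has `O(1)`.
(iii) Leaf (c) — the order-`n̄+1` truncated expectation of the tilted laws, the content of the lemma of [2] p. 152 / of a cluster
expansion — is NOT touched; rows B1.Eq3.24 / B1.Eq3.59 keep their heads.  (iv) In §6 the growth `s^{−p}` of the moment bound and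
the matching extra tail exponent are the bookkeeping by which one `κ` serves every step; print's `κ > d` is the hypothesis `hκ`
of p27's theorem, untouched.  NOT summit progress; NOT Clay.
-/

open Finset MeasureTheory ProbabilityTheory
open Literature.Probability.LatticeModels (setPartitions cumulantOf cumulantOf_eq_sum_setPartitions mem_setPartitions
  IsSetPartition cumulantOf_one cumulantOf_two moment_succ_eq_sum_choose_mul_cumulantOf)
open Literature.MathematicalPhysics.QuantumFieldTheory.Balaban1983to89.B10Eq24Cumulant
open Literature.MathematicalPhysics.QuantumFieldTheory.Balaban1983to89.B1Eq323SetPartitions (truncExp_eq_cumulantOf_nmoment)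
open Literature.MathematicalPhysics.QuantumFieldTheory.Balaban1983to89.B1Eq324CumulantTaylor (eq324_chi)
open scoped Nat

namespace Literature.MathematicalPhysics.QuantumFieldTheory.Balaban1983to89.B1Eq324WeightedCumulantLeaf

noncomputable section

/-! ## §1 Generic algebra: products and cumulants are Lipschitz in the moments -/

section Algebra

/-- FINITE PRODUCTS ARE LIPSCHITZ ON A BOX: if `|aᵢ|, |bᵢ| ≤ R` (`R ≥ 1`) and `|aᵢ − bᵢ| ≤ δ` (`δ ≥ 0`) on `s`, then
`|Π_{i∈s} aᵢ − Π_{i∈s} bᵢ| ≤ |s|·R^{|s|}·δ` (telescoping) — the block-product step of the Möbius form of (3.23) «and so on»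
used in leaf (b) of (3.24). [cite: Balaban1982Higgs1, (3.23) p.616] -/
theorem abs_prod_sub_prod_le {ι : Type*} (s : Finset ι) (a b : ι → ℝ) {R δ : ℝ} (hR : 1 ≤ R) (hδ : 0 ≤ δ)
    (ha : ∀ i ∈ s, |a i| ≤ R) (hb : ∀ i ∈ s, |b i| ≤ R) (hab : ∀ i ∈ s, |a i - b i| ≤ δ) :
    |∏ i ∈ s, a i - ∏ i ∈ s, b i| ≤ s.card * R ^ s.card * δ := by
  induction s using Finset.cons_induction with
  | empty => simp
  | cons i s hi ih =>
    have ha' : ∀ j ∈ s, |a j| ≤ R := fun j hj => ha j (mem_cons_of_mem hj)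
    have hb' : ∀ j ∈ s, |b j| ≤ R := fun j hj => hb j (mem_cons_of_mem hj)
    have hab' : ∀ j ∈ s, |a j - b j| ≤ δ := fun j hj => hab j (mem_cons_of_mem hj)
    have ih' := ih ha' hb' hab'
    have hai : |a i| ≤ R := ha i (mem_cons_self i s)
    have habi : |a i - b i| ≤ δ := hab i (mem_cons_self i s)
    have hR0 : 0 ≤ R := le_trans zero_le_one hR
    have hB : |∏ j ∈ s, b j| ≤ R ^ s.card := by
      rw [Finset.abs_prod]
      calc ∏ j ∈ s, |b j| ≤ ∏ _j ∈ s, R := Finset.prod_le_prod (fun j _ => abs_nonneg _) hb'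
        _ = R ^ s.card := Finset.prod_const R
    rw [prod_cons, prod_cons, card_cons]
    have hsplit : a i * ∏ j ∈ s, a j - b i * ∏ j ∈ s, b j
        = a i * (∏ j ∈ s, a j - ∏ j ∈ s, b j) + (a i - b i) * ∏ j ∈ s, b j := by ring
    rw [hsplit]
    calc |a i * (∏ j ∈ s, a j - ∏ j ∈ s, b j) + (a i - b i) * ∏ j ∈ s, b j|
        ≤ |a i| * |∏ j ∈ s, a j - ∏ j ∈ s, b j| + |a i - b i| * |∏ j ∈ s, b j| := by
          have := abs_add_le (a i * (∏ j ∈ s, a j - ∏ j ∈ s, b j)) ((a i - b i) * ∏ j ∈ s, b j)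
          rw [abs_mul, abs_mul] at this; exact this
      _ ≤ R * (s.card * R ^ s.card * δ) + δ * R ^ s.card := by
          gcongr
      _ = s.card * R ^ (s.card + 1) * δ + R ^ s.card * δ := by ring
      _ ≤ s.card * R ^ (s.card + 1) * δ + R ^ (s.card + 1) * δ := by
          have h1 : R ^ s.card ≤ R ^ (s.card + 1) := pow_le_pow_right₀ hR (Nat.le_succ _)
          have := mul_le_mul_of_nonneg_right h1 hδ
          linarith
      _ = (s.card + 1 : ℕ) * R ^ (s.card + 1) * δ := by push_cast; ring

/-- A set partition of `W` has at most `|W|` blocks (each block is nonempty, the sizes add up to `|W|`,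
`LatticeModels.IsSetPartition.sum_card`); private plumbing. [folklore] -/
private theorem card_blocks_le {α : Type*} {W : Finset α} {π : Finset (Finset α)} (h : IsSetPartition W π) :
    π.card ≤ W.card := by
  classical
  calc π.card = ∑ _P ∈ π, 1 := Finset.card_eq_sum_ones π
    _ ≤ ∑ P ∈ π, P.card := Finset.sum_le_sum fun P hP => Finset.card_pos.2 (h.nonempty_of_mem hP)
    _ = W.card := h.sum_card

/-- THE EXPLICIT LIPSCHITZ CONSTANT of the moment → cumulant map `m ↦ κₙ(m)` at order `n` on the box `|mₖ| ≤ R`: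
`cumLip n R := Σ_{π ∈ 𝒫({1,…,n})} (|π|−1)!·|π|·R^{|π|}` — read off the Möbius formula
`κₙ(m) = Σ_π (−1)^{|π|−1}(|π|−1)! Π_{P∈π} m_{|P|}` (`LatticeModels.cumulantOf_eq_sum_setPartitions`) — the truncated
expectations of (3.23) «and so on» as functions of the moments. [cite: Balaban1982Higgs1, (3.23) p.616] -/
def cumLip (n : ℕ) (R : ℝ) : ℝ :=
  ∑ π ∈ setPartitions (univ : Finset (Fin n)), ((π.card - 1).factorial : ℝ) * (π.card * R ^ π.card)

/-- `cumLip n R ≥ 0` for `R ≥ 0` (constant bookkeeping of (3.23)/(3.24)). [cite: Balaban1982Higgs1, (3.23) p.616] -/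
theorem cumLip_nonneg (n : ℕ) {R : ℝ} (hR : 0 ≤ R) : 0 ≤ cumLip n R :=
  Finset.sum_nonneg fun π _ => by positivity

/-- HOMOGENEITY: `cumLip n (c·M) ≤ Mⁿ·cumLip n c` for `M ≥ 1`, `c ≥ 0` (a partition of `[n]` has `≤ n` blocks) — the
`s`-uniformity bookkeeping of (3.59). [cite: Balaban1982Higgs1, (3.23) p.616] -/
theorem cumLip_mul_le (n : ℕ) {c M : ℝ} (hc : 0 ≤ c) (hM : 1 ≤ M) : cumLip n (c * M) ≤ M ^ n * cumLip n c := by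
  rw [cumLip, cumLip, Finset.mul_sum]
  refine Finset.sum_le_sum fun π hπ => ?_
  have hπn : π.card ≤ n := (card_blocks_le (mem_setPartitions.1 hπ)).trans (by rw [card_univ, Fintype.card_fin])
  have h1 : (c * M) ^ π.card ≤ M ^ n * c ^ π.card := by
    rw [mul_pow, mul_comm]
    exact mul_le_mul_of_nonneg_right (pow_le_pow_right₀ hM hπn) (pow_nonneg hc _)
  have h2 : (0 : ℝ) ≤ ((π.card - 1).factorial : ℝ) * π.card := by positivity
  calc ((π.card - 1).factorial : ℝ) * (π.card * (c * M) ^ π.card)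
      = (((π.card - 1).factorial : ℝ) * π.card) * (c * M) ^ π.card := by ring
    _ ≤ (((π.card - 1).factorial : ℝ) * π.card) * (M ^ n * c ^ π.card) := mul_le_mul_of_nonneg_left h1 h2
    _ = M ^ n * (((π.card - 1).factorial : ℝ) * (π.card * c ^ π.card)) := by ring

/-- **CUMULANTS ARE LIPSCHITZ IN THE MOMENTS**: for moment sequences `m`, `m′` with `m₀ = m′₀ = 1`, `|mₖ|, |m′ₖ| ≤ R`
(`R ≥ 1`) and `|mₖ − m′ₖ| ≤ δ` for `1 ≤ k ≤ n` (`n ≥ 1`):  `|κₙ(m) − κₙ(m′)| ≤ cumLip n R · δ`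
(`κₙ = LatticeModels.cumulantOf`, the truncated expectations of (3.23) as functions of the moments; the Möbius formula termwise
and `abs_prod_sub_prod_le` over the blocks) — the algebraic step of leaf (b) of (3.24). [cite: Balaban1982Higgs1, (3.23) p.616] -/
theorem abs_cumulantOf_sub_cumulantOf_le {m m' : ℕ → ℝ} (h0 : m 0 = 1) (h0' : m' 0 = 1) {n : ℕ} (hn : 0 < n)
    {R δ : ℝ} (hR : 1 ≤ R) (hδ : 0 ≤ δ)
    (hm : ∀ k, 1 ≤ k → k ≤ n → |m k| ≤ R) (hm' : ∀ k, 1 ≤ k → k ≤ n → |m' k| ≤ R)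
    (hd : ∀ k, 1 ≤ k → k ≤ n → |m k - m' k| ≤ δ) :
    |cumulantOf m n - cumulantOf m' n| ≤ cumLip n R * δ := by
  rw [cumulantOf_eq_sum_setPartitions m h0 hn, cumulantOf_eq_sum_setPartitions m' h0' hn, ← Finset.sum_sub_distrib,
    cumLip, Finset.sum_mul]
  refine (Finset.abs_sum_le_sum_abs _ _).trans (Finset.sum_le_sum fun π hπ => ?_)
  have hP := mem_setPartitions.1 hπ
  have hcard : ∀ P ∈ π, 1 ≤ P.card ∧ P.card ≤ n := fun P hPπ =>
    ⟨Finset.card_pos.2 (hP.nonempty_of_mem hPπ), (card_le_univ P).trans (Fintype.card_fin n).le⟩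
  rw [← mul_sub, abs_mul, abs_mul, abs_pow, abs_neg, abs_one, one_pow, one_mul, Nat.abs_cast]
  calc ((π.card - 1).factorial : ℝ) * |∏ P ∈ π, m P.card - ∏ P ∈ π, m' P.card|
      ≤ ((π.card - 1).factorial : ℝ) * (π.card * R ^ π.card * δ) := by
        gcongr
        exact abs_prod_sub_prod_le π (fun P => m P.card) (fun P => m' P.card) hR hδ
          (fun P hPπ => hm _ (hcard P hPπ).1 (hcard P hPπ).2) (fun P hPπ => hm' _ (hcard P hPπ).1 (hcard P hPπ).2)
          (fun P hPπ => hd _ (hcard P hPπ).1 (hcard P hPπ).2)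
    _ = _ := by ring

/-- `κ₃ = m₃ − 3 m₂ m₁ + 2 m₁³` — the third cumulant of a moment sequence (from the moment–cumulant recursion
`LatticeModels.moment_succ_eq_sum_choose_mul_cumulantOf`; the coefficient `2` that print's (3.23) p. 616 misprints as `1`,
cf. `B1Sect3Statements.trunc3_printed`, `B10Eq24Cumulant.truncExp_three`). [cite: Balaban1982Higgs1, (3.23) p.616] -/
theorem cumulantOf_three (m : ℕ → ℝ) (h0 : m 0 = 1) :
    cumulantOf m 3 = m 3 - 3 * m 2 * m 1 + 2 * m 1 ^ 3 := by
  have h := moment_succ_eq_sum_choose_mul_cumulantOf m h0 2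
  have c21 : Nat.choose 2 1 = 2 := by decide
  simp only [Finset.sum_range_succ, Finset.sum_range_zero, zero_add, Nat.choose_zero_right, Nat.choose_self, c21,
    Nat.cast_one, Nat.cast_ofNat, one_mul, Nat.sub_zero, Nat.sub_self, h0, mul_one, Nat.reduceAdd,
    Nat.reduceSub, cumulantOf_one, cumulantOf_two m h0] at h
  linear_combination (-1 : ℝ) * h

end Algebra

/-! ## §2 A weighted Cauchy–Schwarz inequality -/

section CauchySchwarz

variable {Ω : Type*} {mΩ : MeasurableSpace Ω} {μ : Measure Ω}

/-- WEIGHTED CAUCHY–SCHWARZ: for a weight `0 ≤ w ≤ 1` and `g ∈ L²(μ)` (`μ` finite),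
`|∫ w g dμ| ≤ √(∫ w dμ) · √(∫ g² dμ)` — Hölder with `p = q = 2` for `w·|g|`, then `w² ≤ w`; the analytic step of leaf (b)
of (3.24) (with `w = 1 − χ`, the complement of the characteristic functions). [cite: Balaban1982Higgs1, (3.24) p.616] -/
theorem abs_integral_mul_le_sqrt_mul_sqrt [IsFiniteMeasure μ] {w g : Ω → ℝ} (hwm : AEStronglyMeasurable w μ)
    (hw0 : ∀ ω, 0 ≤ w ω) (hw1 : ∀ ω, w ω ≤ 1) (hg : MemLp g 2 μ) :
    |∫ ω, w ω * g ω ∂μ| ≤ Real.sqrt (∫ ω, w ω ∂μ) * Real.sqrt (∫ ω, g ω ^ 2 ∂μ) := by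
  have h1 : |∫ ω, w ω * g ω ∂μ| ≤ ∫ ω, w ω * |g ω| ∂μ := by
    calc |∫ ω, w ω * g ω ∂μ| ≤ ∫ ω, |w ω * g ω| ∂μ := abs_integral_le_integral_abs
      _ = ∫ ω, w ω * |g ω| ∂μ := integral_congr_ae (ae_of_all _ fun ω => by
          show |w ω * g ω| = w ω * |g ω|
          rw [abs_mul, abs_of_nonneg (hw0 ω)])
  have hpq : Real.HolderConjugate 2 2 := ⟨by norm_num, by norm_num, by norm_num⟩
  have h2eq : ENNReal.ofReal 2 = 2 := by norm_num
  have hwb : ∀ᵐ ω ∂μ, ‖w ω‖ ≤ 1 := ae_of_all _ fun ω => by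
    rw [Real.norm_eq_abs, abs_of_nonneg (hw0 ω)]; exact hw1 ω
  have hwLp : MemLp w (ENNReal.ofReal 2) μ := MemLp.of_bound hwm 1 hwb
  have hgLp : MemLp (fun ω => |g ω|) (ENNReal.ofReal 2) μ := by rw [h2eq]; exact hg.abs
  have h2 := integral_mul_le_Lp_mul_Lq_of_nonneg hpq (ae_of_all _ hw0) (ae_of_all _ fun ω => abs_nonneg (g ω)) hwLp hgLp
  have hA : (∫ ω, w ω ^ (2 : ℝ) ∂μ) = ∫ ω, w ω ^ 2 ∂μ :=
    integral_congr_ae (ae_of_all _ fun ω => by show w ω ^ (2 : ℝ) = w ω ^ 2; rw [Real.rpow_two])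
  have hB : (∫ ω, |g ω| ^ (2 : ℝ) ∂μ) = ∫ ω, g ω ^ 2 ∂μ :=
    integral_congr_ae (ae_of_all _ fun ω => by show |g ω| ^ (2 : ℝ) = g ω ^ 2; rw [Real.rpow_two, sq_abs])
  rw [hA, hB, ← Real.sqrt_eq_rpow, ← Real.sqrt_eq_rpow] at h2
  have hw_int : Integrable w μ := (integrable_const (1 : ℝ)).mono' hwm hwb
  have hw2_le : ∫ ω, w ω ^ 2 ∂μ ≤ ∫ ω, w ω ∂μ := by
    refine integral_mono_of_nonneg (ae_of_all _ fun ω => sq_nonneg (w ω)) hw_int (ae_of_all _ fun ω => ?_)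
    calc w ω ^ 2 = w ω * w ω := sq (w ω)
      _ ≤ 1 * w ω := mul_le_mul_of_nonneg_right (hw1 ω) (hw0 ω)
      _ = w ω := one_mul _
  calc |∫ ω, w ω * g ω ∂μ| ≤ ∫ ω, w ω * |g ω| ∂μ := h1
    _ ≤ Real.sqrt (∫ ω, w ω ^ 2 ∂μ) * Real.sqrt (∫ ω, g ω ^ 2 ∂μ) := h2
    _ ≤ Real.sqrt (∫ ω, w ω ∂μ) * Real.sqrt (∫ ω, g ω ^ 2 ∂μ) := by
        gcongr

/-- `|⟨g⟩| ≤ ‖g‖_{L²(μ)}` on a probability space (the weight `w = 1`; the moment box of leaf (b) of (3.24)).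
[cite: Balaban1982Higgs1, (3.24) p.616] -/
theorem abs_integral_le_sqrt_integral_sq [IsProbabilityMeasure μ] {g : Ω → ℝ} (hg : MemLp g 2 μ) :
    |∫ ω, g ω ∂μ| ≤ Real.sqrt (∫ ω, g ω ^ 2 ∂μ) := by
  have h := abs_integral_mul_le_sqrt_mul_sqrt (μ := μ) (w := fun _ => (1 : ℝ)) aestronglyMeasurable_const
    (fun _ => zero_le_one) (fun _ => le_rfl) hg
  simpa only [one_mul, integral_const, probReal_univ, smul_eq_mul, mul_one, Real.sqrt_one] using h

end CauchySchwarz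

/-! ## §3 Tilting by the characteristic function `χ`: how far the moments move -/

section Tilt

variable {Ω : Type*} {mΩ : MeasurableSpace Ω} {μ : Measure Ω} [IsProbabilityMeasure μ] {χ V : Ω → ℝ}

/-- Under a probability measure the normalised moment `B10Eq24Cumulant.nmoment V μ k` is the plain moment `∫ Vᵏ dμ`
(print's `⟨Vᵏ⟩` for the unweighted law `⟨·⟩` of (3.23)). [cite: Balaban1982Higgs1, (3.23) p.616] -/
theorem nmoment_eq_integral (V : Ω → ℝ) (k : ℕ) : nmoment V μ k = ∫ ω, V ω ^ k ∂μ := by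
  rw [nmoment, probReal_univ, div_one]

omit [IsProbabilityMeasure μ] in
/-- The normalised moments of the χ-weighted law `χ·μ` (`B10Eq24Cumulant.chiMeasure`): `⟨Vᵏ⟩_{χμ} = ⟨χ Vᵏ⟩ / ⟨χ⟩` — print's
`⟨·⟩` with the characteristic functions inserted and normalised. [cite: Balaban1982Higgs1, (3.24) p.616] -/
theorem nmoment_chiMeasure (hχm : Measurable χ) (hχ0 : ∀ ω, 0 ≤ χ ω) (V : Ω → ℝ) (k : ℕ) :
    nmoment V (chiMeasure μ χ) k = (∫ ω, χ ω * V ω ^ k ∂μ) / ∫ ω, χ ω ∂μ := by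
  rw [nmoment, integral_chiMeasure hχm hχ0, chiMeasure_real_univ hχm hχ0]

/-- A characteristic function `0 ≤ χ ≤ 1` is integrable; private plumbing. [folklore] -/
private theorem integrable_chi (hχm : Measurable χ) (hχ0 : ∀ ω, 0 ≤ χ ω) (hχ1 : ∀ ω, χ ω ≤ 1) : Integrable χ μ :=
  (integrable_const (1 : ℝ)).mono' hχm.aestronglyMeasurable
    (ae_of_all _ fun ω => by rw [Real.norm_eq_abs, abs_of_nonneg (hχ0 ω)]; exact hχ1 ω)

/-- THE ALGEBRA OF TILTING: `⟨χ f⟩ − ⟨χ⟩⟨f⟩ = −⟨(1−χ) f⟩ + ⟨1−χ⟩⟨f⟩` (`μ` a probability measure, `f` integrable) — inserting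
the characteristic functions `χ` of (3.24) into an expectation. [cite: Balaban1982Higgs1, (3.24) p.616] -/
theorem integral_chi_mul_sub (hχm : Measurable χ) (hχ0 : ∀ ω, 0 ≤ χ ω) (hχ1 : ∀ ω, χ ω ≤ 1) {f : Ω → ℝ}
    (hf : Integrable f μ) :
    ∫ ω, χ ω * f ω ∂μ - (∫ ω, χ ω ∂μ) * ∫ ω, f ω ∂μ
      = -(∫ ω, (1 - χ ω) * f ω ∂μ) + (∫ ω, (1 - χ ω) ∂μ) * ∫ ω, f ω ∂μ := by
  have hχf : Integrable (fun ω => χ ω * f ω) μ :=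
    hf.bdd_mul hχm.aestronglyMeasurable
      (ae_of_all _ fun ω => by rw [Real.norm_eq_abs, abs_of_nonneg (hχ0 ω)]; exact hχ1 ω)
  have h1 : ∫ ω, (1 - χ ω) * f ω ∂μ = ∫ ω, f ω ∂μ - ∫ ω, χ ω * f ω ∂μ := by
    rw [← integral_sub hf hχf]
    exact integral_congr_ae (ae_of_all _ fun ω => by ring)
  have h2 : ∫ ω, (1 - χ ω) ∂μ = 1 - ∫ ω, χ ω ∂μ := by
    rw [integral_sub (integrable_const 1) (integrable_chi hχm hχ0 hχ1), integral_const, probReal_univ, one_smul]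
  rw [h1, h2]; ring

/-- **TILTING BY χ MOVES A MOMENT BY LITTLE**: for a probability measure `μ`, measurable `0 ≤ χ ≤ 1` with `⟨χ⟩ > 0` and
`Vᵏ ∈ L²(μ)`,  `|⟨Vᵏ⟩_{χμ} − ⟨Vᵏ⟩_μ| ≤ (√⟨1−χ⟩ · ‖Vᵏ‖_{L²(μ)} + ⟨1−χ⟩ · |⟨Vᵏ⟩_μ|) / ⟨χ⟩` (the tilting algebra and the weighted
Cauchy–Schwarz inequality with `w = 1 − χ`). [cite: Balaban1982Higgs1, (3.24) p.616] -/
theorem abs_nmoment_chiMeasure_sub_le (hχm : Measurable χ) (hχ0 : ∀ ω, 0 ≤ χ ω) (hχ1 : ∀ ω, χ ω ≤ 1)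
    (hZ : 0 < ∫ ω, χ ω ∂μ) {k : ℕ} (hVk : MemLp (fun ω => V ω ^ k) 2 μ) :
    |nmoment V (chiMeasure μ χ) k - nmoment V μ k|
      ≤ (Real.sqrt (∫ ω, (1 - χ ω) ∂μ) * Real.sqrt (∫ ω, (V ω ^ k) ^ 2 ∂μ)
          + (∫ ω, (1 - χ ω) ∂μ) * |∫ ω, V ω ^ k ∂μ|) / ∫ ω, χ ω ∂μ := by
  have hf : Integrable (fun ω => V ω ^ k) μ := hVk.integrable one_le_two
  rw [nmoment_chiMeasure hχm hχ0, nmoment_eq_integral, le_div_iff₀ hZ]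
  have hkey : (∫ ω, χ ω * V ω ^ k ∂μ) / (∫ ω, χ ω ∂μ) - ∫ ω, V ω ^ k ∂μ
      = (∫ ω, χ ω * V ω ^ k ∂μ - (∫ ω, χ ω ∂μ) * ∫ ω, V ω ^ k ∂μ) / ∫ ω, χ ω ∂μ := by
    field_simp
  rw [hkey, abs_div, abs_of_pos hZ, div_mul_cancel₀ _ hZ.ne', integral_chi_mul_sub hχm hχ0 hχ1 hf]
  have h1χm : AEStronglyMeasurable (fun ω => 1 - χ ω) μ := (measurable_const.sub hχm).aestronglyMeasurable
  have hcs := abs_integral_mul_le_sqrt_mul_sqrt h1χm (fun ω => sub_nonneg.2 (hχ1 ω))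
    (fun ω => by linarith [hχ0 ω]) hVk
  have hτ0 : 0 ≤ ∫ ω, (1 - χ ω) ∂μ := integral_nonneg fun ω => sub_nonneg.2 (hχ1 ω)
  calc |-(∫ ω, (1 - χ ω) * V ω ^ k ∂μ) + (∫ ω, (1 - χ ω) ∂μ) * ∫ ω, V ω ^ k ∂μ|
      ≤ |-(∫ ω, (1 - χ ω) * V ω ^ k ∂μ)| + |(∫ ω, (1 - χ ω) ∂μ) * ∫ ω, V ω ^ k ∂μ| := abs_add_le _ _
    _ ≤ _ := by
        rw [abs_neg, abs_mul, abs_of_nonneg hτ0]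
        gcongr

/-- … the ONE-TERM FORM: `|⟨Vᵏ⟩_{χμ} − ⟨Vᵏ⟩_μ| ≤ 2√⟨1−χ⟩ · ‖Vᵏ‖_{L²(μ)} / ⟨χ⟩` (`⟨1−χ⟩ ≤ √⟨1−χ⟩ ≤ 1` and
`|⟨Vᵏ⟩| ≤ ‖Vᵏ‖₂`). [cite: Balaban1982Higgs1, (3.24) p.616] -/
theorem abs_nmoment_chiMeasure_sub_le' (hχm : Measurable χ) (hχ0 : ∀ ω, 0 ≤ χ ω) (hχ1 : ∀ ω, χ ω ≤ 1)
    (hZ : 0 < ∫ ω, χ ω ∂μ) {k : ℕ} (hVk : MemLp (fun ω => V ω ^ k) 2 μ) :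
    |nmoment V (chiMeasure μ χ) k - nmoment V μ k|
      ≤ 2 * Real.sqrt (∫ ω, (1 - χ ω) ∂μ) * Real.sqrt (∫ ω, (V ω ^ k) ^ 2 ∂μ) / ∫ ω, χ ω ∂μ := by
  refine (abs_nmoment_chiMeasure_sub_le hχm hχ0 hχ1 hZ hVk).trans ?_
  have hτ0 : 0 ≤ ∫ ω, (1 - χ ω) ∂μ := integral_nonneg fun ω => sub_nonneg.2 (hχ1 ω)
  have hτ1 : ∫ ω, (1 - χ ω) ∂μ ≤ 1 := by
    rw [integral_sub (integrable_const 1) (integrable_chi hχm hχ0 hχ1), integral_const, probReal_univ, one_smul]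
    linarith
  have hττ : ∫ ω, (1 - χ ω) ∂μ ≤ Real.sqrt (∫ ω, (1 - χ ω) ∂μ) := by
    have := Real.sqrt_le_sqrt (mul_le_of_le_one_left hτ0 hτ1)
    rwa [Real.sqrt_mul_self hτ0] at this
  have hI := abs_integral_le_sqrt_integral_sq hVk
  rw [div_le_div_iff_of_pos_right hZ]
  have hs0 : 0 ≤ Real.sqrt (∫ ω, (V ω ^ k) ^ 2 ∂μ) := Real.sqrt_nonneg _
  nlinarith [mul_le_mul hττ hI (abs_nonneg _) (Real.sqrt_nonneg _)]

end Tilt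

/-! ## §4 Leaf (b): print's cumulants versus the truncated expectations of the χ-weighted law -/

section Leaf

/-- THE CONSTANT OF LEAF (b): `leafBConst n̄ M := 4M · Σ_{n=1}^{n̄} cumLip n (5M) / n!` (moments in the box `5M`, moved by
`≤ 4√⟨1−χ⟩·M`). [cite: Balaban1982Higgs1, (3.24) p.616] -/
def leafBConst (nbar : ℕ) (M : ℝ) : ℝ :=
  4 * M * ∑ n ∈ Finset.Icc 1 nbar, cumLip n (5 * M) / (n ! : ℝ)

/-- `leafBConst n̄ M ≥ 0` for `M ≥ 0` (constant bookkeeping of (3.24)). [cite: Balaban1982Higgs1, (3.24) p.616] -/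
theorem leafBConst_nonneg (nbar : ℕ) {M : ℝ} (hM : 0 ≤ M) : 0 ≤ leafBConst nbar M := by
  unfold leafBConst
  have : 0 ≤ ∑ n ∈ Finset.Icc 1 nbar, cumLip n (5 * M) / (n ! : ℝ) :=
    Finset.sum_nonneg fun n _ => div_nonneg (cumLip_nonneg n (by positivity)) (by positivity)
  positivity

/-- POLYNOMIAL GROWTH IN THE MOMENT BOUND: `leafBConst n̄ M ≤ leafBConst n̄ 1 · M^{n̄+1}` for `M ≥ 1` (`cumLip_mul_le`) — the
`s`-uniformity bookkeeping of (3.59). [cite: Balaban1982Higgs1, (3.59) p.623] -/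
theorem leafBConst_le_pow (nbar : ℕ) {M : ℝ} (hM : 1 ≤ M) :
    leafBConst nbar M ≤ leafBConst nbar 1 * M ^ (nbar + 1) := by
  have hM0 : 0 ≤ M := zero_le_one.trans hM
  unfold leafBConst
  rw [mul_one, mul_assoc (4 : ℝ) M, mul_assoc (4 : ℝ)]
  refine mul_le_mul_of_nonneg_left ?_ (by norm_num)
  rw [Finset.mul_sum, Finset.sum_mul]
  refine Finset.sum_le_sum fun n hn => ?_
  have hn' : n ≤ nbar := (Finset.mem_Icc.1 hn).2
  have h1 : cumLip n (5 * M) ≤ M ^ n * cumLip n 5 := cumLip_mul_le n (by norm_num) hM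
  have h2 : M * M ^ n ≤ M ^ (nbar + 1) := by
    rw [← pow_succ']; exact pow_le_pow_right₀ hM (Nat.succ_le_succ hn')
  have h3 : 0 ≤ cumLip n 5 := cumLip_nonneg n (by norm_num)
  have hf : (0 : ℝ) < n ! := by positivity
  rw [mul_div_assoc', div_le_iff₀ hf, mul_comm (cumLip n (5 * 1) / _), mul_div_assoc', div_mul_cancel₀ _ hf.ne',
    mul_one]
  calc M * cumLip n (5 * M) ≤ M * (M ^ n * cumLip n 5) := mul_le_mul_of_nonneg_left h1 hM0
    _ = (M * M ^ n) * cumLip n 5 := by ring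
    _ ≤ M ^ (nbar + 1) * cumLip n 5 := mul_le_mul_of_nonneg_right h2 h3

variable {Ω : Type*} {mΩ : MeasurableSpace Ω} {μ : Measure Ω} [IsProbabilityMeasure μ] {χ V : Ω → ℝ} {B : ℝ}

/-- **LEAF (b) OF (3.24)/(3.59) — THE CHARACTERISTIC FUNCTIONS CHANGE THE CUMULANTS BY `O(√⟨1−χ⟩)`.**  `μ` a probability
measure (print's `⟨·⟩`, the Gaussian law `dμ_{C⁽⁰⁾}(A′)dμ_{C⁽⁰⁾(B⁽¹⁾)}(φ′)`), `χ` measurable with `0 ≤ χ ≤ 1` and `⟨χ⟩ ≥ ½`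
(the product of small-field characteristic functions, whose tail `⟨1 − χ⟩ ≤ ½` by `B1Eq324SmallFieldLeaf.one_sub_integral_chiFluct*_le`
once `ε` is small), `V` μ-a.e.-measurable
with `|V| ≤ B` on `{χ ≠ 0}` and `‖Vᵏ‖_{L²(μ)} ≤ M` for `1 ≤ k ≤ n̄` (`M ≥ 1`).  Then the cumulants `κₙ(⟨V^·⟩_μ)` written on the
RIGHT of (3.24) and the truncated expectations `⟨Vⁿ⟩ᵀ_{χμ}` of the χ-WEIGHTED law (those produced by the Taylor expansion of
`log⟨χ e^{tV}⟩`, `B10Eq24Cumulant.cgf_taylor_lagrange`) satisfy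
`|Σ_{n=1}^{n̄} (κₙ(⟨V^·⟩_μ) − ⟨Vⁿ⟩ᵀ_{χμ}) / n!| ≤ leafBConst n̄ M · √⟨1 − χ⟩`. [cite: Balaban1982Higgs1, (3.24) p.616] -/
theorem abs_sum_cumulantOf_sub_truncExp_le (hχm : Measurable χ) (hχ0 : ∀ ω, 0 ≤ χ ω) (hχ1 : ∀ ω, χ ω ≤ 1)
    (hZ : 1 / 2 ≤ ∫ ω, χ ω ∂μ) (hVm : AEMeasurable V μ) (hVB : ∀ ω, χ ω ≠ 0 → |V ω| ≤ B) (nbar : ℕ)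
    {M : ℝ} (hM : 1 ≤ M) (hV2 : ∀ k, 1 ≤ k → k ≤ nbar → MemLp (fun ω => V ω ^ k) 2 μ)
    (hVM : ∀ k, 1 ≤ k → k ≤ nbar → Real.sqrt (∫ ω, (V ω ^ k) ^ 2 ∂μ) ≤ M) :
    |∑ n ∈ Finset.Icc 1 nbar, (cumulantOf (nmoment V μ) n - truncExp V (chiMeasure μ χ) n) / (n ! : ℝ)|
      ≤ leafBConst nbar M * Real.sqrt (∫ ω, (1 - χ ω) ∂μ) := by
  have hZpos : 0 < ∫ ω, χ ω ∂μ := lt_of_lt_of_le (by norm_num) hZ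
  haveI := isFiniteMeasure_chiMeasure (μ := μ) hχm hχ0 hχ1
  haveI := neZero_chiMeasure (μ := μ) hχm hχ0 hZpos
  set ν := chiMeasure μ χ with hν
  set τ := ∫ ω, (1 - χ ω) ∂μ with hτ
  have hτ1 : τ ≤ 1 := by
    rw [hτ, integral_sub (integrable_const 1) (integrable_chi hχm hχ0 hχ1), integral_const, probReal_univ, one_smul]
    linarith
  have hsτ1 : Real.sqrt τ ≤ 1 := Real.sqrt_le_one.mpr hτ1
  have hM0 : 0 ≤ M := zero_le_one.trans hM
  have hVν : AEMeasurable V ν := aemeasurable_chiMeasure hVm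
  have hBν : ∀ᵐ ω ∂ν, |V ω| ≤ B := ae_chiMeasure_abs_le hχm hVB
  -- how far the moments move, and the box containing both moment sequences
  have hdiff : ∀ k, 1 ≤ k → k ≤ nbar → |nmoment V μ k - nmoment V ν k| ≤ 4 * Real.sqrt τ * M := by
    intro k hk1 hk2
    rw [abs_sub_comm]
    refine (abs_nmoment_chiMeasure_sub_le' hχm hχ0 hχ1 hZpos (hV2 k hk1 hk2)).trans ?_
    rw [div_le_iff₀ hZpos]
    have := hVM k hk1 hk2
    have hs0 := Real.sqrt_nonneg τ
    nlinarith [mul_le_mul_of_nonneg_left this hs0, mul_nonneg hs0 hM0]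
  have hbox : ∀ k, 1 ≤ k → k ≤ nbar → |nmoment V μ k| ≤ 5 * M := by
    intro k hk1 hk2
    rw [nmoment_eq_integral]
    have := (abs_integral_le_sqrt_integral_sq (hV2 k hk1 hk2)).trans (hVM k hk1 hk2)
    linarith
  have hbox' : ∀ k, 1 ≤ k → k ≤ nbar → |nmoment V ν k| ≤ 5 * M := by
    intro k hk1 hk2
    have h1 := hdiff k hk1 hk2
    have h2 : |nmoment V μ k| ≤ M := by
      rw [nmoment_eq_integral]
      exact (abs_integral_le_sqrt_integral_sq (hV2 k hk1 hk2)).trans (hVM k hk1 hk2)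
    have h3 := abs_sub_abs_le_abs_sub (nmoment V ν k) (nmoment V μ k)
    rw [abs_sub_comm] at h3
    nlinarith [mul_le_of_le_one_left hM0 hsτ1]
  -- order by order: `⟨Vⁿ⟩ᵀ_ν = κₙ(⟨V^·⟩_ν)` (p36) and the Lipschitz estimate of §1
  have hord : ∀ n ∈ Finset.Icc 1 nbar, |(cumulantOf (nmoment V μ) n - truncExp V ν n) / (n ! : ℝ)|
      ≤ cumLip n (5 * M) * (4 * Real.sqrt τ * M) / (n ! : ℝ) := by
    intro n hn
    obtain ⟨hn1, hn2⟩ := Finset.mem_Icc.1 hn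
    rw [abs_div, Nat.abs_cast, truncExp_eq_cumulantOf_nmoment hVν hBν hn1]
    refine div_le_div_of_nonneg_right ?_ (by positivity)
    exact abs_cumulantOf_sub_cumulantOf_le (nmoment_zero V) (nmoment_zero V) hn1 (by linarith) (by positivity)
      (fun k hk1 hk2 => hbox k hk1 (hk2.trans hn2)) (fun k hk1 hk2 => hbox' k hk1 (hk2.trans hn2))
      (fun k hk1 hk2 => hdiff k hk1 (hk2.trans hn2))
  calc |∑ n ∈ Finset.Icc 1 nbar, (cumulantOf (nmoment V μ) n - truncExp V ν n) / (n ! : ℝ)|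
      ≤ ∑ n ∈ Finset.Icc 1 nbar, |(cumulantOf (nmoment V μ) n - truncExp V ν n) / (n ! : ℝ)| :=
        Finset.abs_sum_le_sum_abs _ _
    _ ≤ ∑ n ∈ Finset.Icc 1 nbar, cumLip n (5 * M) * (4 * Real.sqrt τ * M) / (n ! : ℝ) := Finset.sum_le_sum hord
    _ = leafBConst nbar M * Real.sqrt τ := by
        rw [leafBConst, Finset.mul_sum, Finset.sum_mul]
        exact Finset.sum_congr rfl fun n _ => by ring

/-- `√(a·s^{2κ}·vol) ≤ √a · s^κ · vol` for `a, s ≥ 0`, `vol ≥ 1` (arithmetic of the printed power form); private plumbing.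
[folklore] -/
private theorem sqrt_mul_rpow_mul_le {a s κ vol : ℝ} (ha0 : 0 ≤ a) (hs0 : 0 ≤ s) (hvol : 1 ≤ vol) :
    Real.sqrt (a * s ^ (2 * κ) * vol) ≤ Real.sqrt a * s ^ κ * vol := by
  have hsk : 0 ≤ s ^ κ := Real.rpow_nonneg hs0 κ
  have h1 : s ^ (2 * κ) = (s ^ κ) ^ 2 := by
    rw [mul_comm, Real.rpow_mul hs0, Real.rpow_two]
  rw [h1, Real.sqrt_mul (mul_nonneg ha0 (sq_nonneg _)), Real.sqrt_mul ha0, Real.sqrt_sq hsk]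
  have hv1 : 1 ≤ Real.sqrt vol := Real.one_le_sqrt.2 hvol
  have hv : Real.sqrt vol ≤ vol := by
    calc Real.sqrt vol ≤ Real.sqrt vol * Real.sqrt vol := le_mul_of_one_le_right (zero_le_one.trans hv1) hv1
      _ = vol := Real.mul_self_sqrt (zero_le_one.trans hvol)
  exact mul_le_mul_of_nonneg_left hv (mul_nonneg (Real.sqrt_nonneg a) hsk)

/-- **LEAF (b) IN THE PRINTED FORM `O(ε^κ)|T₁|`** — EXACTLY the hypothesis `hb` of p27's `B1Eq324CumulantTaylor.eq324_chi`
with `cum = cumulantOf (nmoment V μ)`: if moreover the tail of the characteristic functions satisfies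
`⟨1 − χ⟩ ≤ a·s^{2κ}·vol` (`s = ε` resp. `L^kε`, `vol = |T₁|` resp. `|T₁^{(k)}| ≥ 1`; for every `K`,
`⟨1 − χ⟩ ≤ 2d|T|s^K` by the union bound of `B1Eq324SmallFieldLeaf`), then
`|Σ_{n=1}^{n̄} (κₙ(⟨V^·⟩_μ) − ⟨Vⁿ⟩ᵀ_{χμ}) / n!| ≤ (leafBConst n̄ M · √a) · s^κ · vol`. [cite: Balaban1982Higgs1, (3.24) p.616] -/
theorem abs_sum_cumulantOf_sub_truncExp_le_pow (hχm : Measurable χ) (hχ0 : ∀ ω, 0 ≤ χ ω) (hχ1 : ∀ ω, χ ω ≤ 1)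
    (hZ : 1 / 2 ≤ ∫ ω, χ ω ∂μ) (hVm : AEMeasurable V μ) (hVB : ∀ ω, χ ω ≠ 0 → |V ω| ≤ B) (nbar : ℕ)
    {M : ℝ} (hM : 1 ≤ M) (hV2 : ∀ k, 1 ≤ k → k ≤ nbar → MemLp (fun ω => V ω ^ k) 2 μ)
    (hVM : ∀ k, 1 ≤ k → k ≤ nbar → Real.sqrt (∫ ω, (V ω ^ k) ^ 2 ∂μ) ≤ M)
    {a s κ vol : ℝ} (ha0 : 0 ≤ a) (hs0 : 0 ≤ s) (hvol : 1 ≤ vol)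
    (hτ : ∫ ω, (1 - χ ω) ∂μ ≤ a * s ^ (2 * κ) * vol) :
    |∑ n ∈ Finset.Icc 1 nbar, (cumulantOf (nmoment V μ) n - truncExp V (chiMeasure μ χ) n) / (n ! : ℝ)|
      ≤ (leafBConst nbar M * Real.sqrt a) * s ^ κ * vol := by
  refine (abs_sum_cumulantOf_sub_truncExp_le hχm hχ0 hχ1 hZ hVm hVB nbar hM hV2 hVM).trans ?_
  have hC := leafBConst_nonneg nbar (zero_le_one.trans hM)
  calc leafBConst nbar M * Real.sqrt (∫ ω, (1 - χ ω) ∂μ)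
      ≤ leafBConst nbar M * Real.sqrt (a * s ^ (2 * κ) * vol) :=
        mul_le_mul_of_nonneg_left (Real.sqrt_le_sqrt hτ) hC
    _ ≤ leafBConst nbar M * (Real.sqrt a * s ^ κ * vol) :=
        mul_le_mul_of_nonneg_left (sqrt_mul_rpow_mul_le ha0 hs0 hvol) hC
    _ = _ := by ring

/-- **… THE (3.59)-UNIFORM SHAPE**: at the k-th step the moments of `V^{(k)}` grow with the number of sites, say
`‖Vᵏ‖₂ ≤ M ≤ M₀·s^{−p}` (`s = L^kε ∈ (0,1]`); then, with `s`-FREE constants,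
`|Σ_{n=1}^{n̄} (κₙ(⟨V^·⟩_μ) − ⟨Vⁿ⟩ᵀ_{χμ}) / n!| ≤ (leafBConst n̄ 1 · M₀^{n̄+1} · √a) · s^{κ − p(n̄+1)} · vol` — print's
`O(1)(L^kε)^κ|T₁^{(k)}|` with `κ` at our disposal (the `K` of the tail is arbitrary, II p. 557).
[cite: Balaban1982Higgs1, (3.59) p.623] -/
theorem abs_sum_cumulantOf_sub_truncExp_le_pow' (hχm : Measurable χ) (hχ0 : ∀ ω, 0 ≤ χ ω) (hχ1 : ∀ ω, χ ω ≤ 1)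
    (hZ : 1 / 2 ≤ ∫ ω, χ ω ∂μ) (hVm : AEMeasurable V μ) (hVB : ∀ ω, χ ω ≠ 0 → |V ω| ≤ B) (nbar : ℕ)
    {M : ℝ} (hM : 1 ≤ M) (hV2 : ∀ k, 1 ≤ k → k ≤ nbar → MemLp (fun ω => V ω ^ k) 2 μ)
    (hVM : ∀ k, 1 ≤ k → k ≤ nbar → Real.sqrt (∫ ω, (V ω ^ k) ^ 2 ∂μ) ≤ M)
    {a s κ vol M₀ p : ℝ} (ha0 : 0 ≤ a) (hs0 : 0 < s) (hvol : 1 ≤ vol)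
    (hτ : ∫ ω, (1 - χ ω) ∂μ ≤ a * s ^ (2 * κ) * vol) (hMM₀ : M ≤ M₀ * s ^ (-p)) :
    |∑ n ∈ Finset.Icc 1 nbar, (cumulantOf (nmoment V μ) n - truncExp V (chiMeasure μ χ) n) / (n ! : ℝ)|
      ≤ (leafBConst nbar 1 * M₀ ^ (nbar + 1) * Real.sqrt a) * s ^ (κ - p * (nbar + 1)) * vol := by
  refine (abs_sum_cumulantOf_sub_truncExp_le_pow hχm hχ0 hχ1 hZ hVm hVB nbar hM hV2 hVM ha0 hs0.le hvol hτ).trans ?_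
  have hM0 : 0 ≤ M := zero_le_one.trans hM
  have h1 : leafBConst nbar M ≤ leafBConst nbar 1 * M ^ (nbar + 1) := leafBConst_le_pow nbar hM
  have h2 : M ^ (nbar + 1) ≤ (M₀ * s ^ (-p)) ^ (nbar + 1) := pow_le_pow_left₀ hM0 hMM₀ _
  have h3 : (M₀ * s ^ (-p)) ^ (nbar + 1) = M₀ ^ (nbar + 1) * s ^ (-p * (nbar + 1)) := by
    rw [mul_pow, ← Real.rpow_natCast (s ^ (-p)) (nbar + 1), ← Real.rpow_mul hs0.le]
    congr 2
    push_cast; ring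
  have h4 : s ^ (-p * (nbar + 1)) * s ^ κ = s ^ (κ - p * (nbar + 1)) := by
    rw [← Real.rpow_add hs0]; congr 1; ring
  have hC1 : 0 ≤ leafBConst nbar 1 := leafBConst_nonneg nbar zero_le_one
  have hrest : 0 ≤ Real.sqrt a * s ^ κ * vol :=
    mul_nonneg (mul_nonneg (Real.sqrt_nonneg a) (Real.rpow_nonneg hs0.le κ)) (zero_le_one.trans hvol)
  calc leafBConst nbar M * Real.sqrt a * s ^ κ * vol = leafBConst nbar M * (Real.sqrt a * s ^ κ * vol) := by ring
    _ ≤ (leafBConst nbar 1 * (M₀ ^ (nbar + 1) * s ^ (-p * (nbar + 1)))) * (Real.sqrt a * s ^ κ * vol) := by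
        refine mul_le_mul_of_nonneg_right ?_ hrest
        rw [← h3]; exact h1.trans (mul_le_mul_of_nonneg_left h2 hC1)
    _ = leafBConst nbar 1 * M₀ ^ (nbar + 1) * Real.sqrt a * (s ^ (-p * (nbar + 1)) * s ^ κ) * vol := by ring
    _ = _ := by rw [h4]

end Leaf

/-! ## §5 Knitting: r12's printed carriers `trunc2`/`trunc3`, and (3.24) with print's cumulants via p27's `eq324_chi` -/

section Knitting

variable {Ω : Type*} {mΩ : MeasurableSpace Ω} {μ : Measure Ω} [IsProbabilityMeasure μ] {χ V : Ω → ℝ} {B : ℝ}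

/-- **(3.23), order 2, for the unweighted law**: `κ₂(⟨V^·⟩_μ) = trunc2 ⟨V⟩ ⟨V²⟩ = ⟨V²⟩ − ⟨V⟩²` (r12's carrier
`B1Sect3Statements.trunc2`). [cite: Balaban1982Higgs1, (3.23) p.616] -/
theorem cumulantOf_nmoment_two (V : Ω → ℝ) :
    cumulantOf (nmoment V μ) 2 = B1Sect3Statements.trunc2 (∫ ω, V ω ∂μ) (∫ ω, V ω ^ 2 ∂μ) := by
  rw [cumulantOf_two _ (nmoment_zero V), nmoment_eq_integral, nmoment_eq_integral, B1Sect3Statements.trunc2]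
  simp only [pow_one]; ring

/-- **(3.23), order 3, for the unweighted law**: `κ₃(⟨V^·⟩_μ) = trunc3 ⟨V⟩ ⟨V²⟩ ⟨V³⟩ = ⟨V³⟩ − 3⟨V²⟩⟨V⟩ + 2⟨V⟩³` (r12's
carrier `B1Sect3Statements.trunc3`, the corrected third formula). [cite: Balaban1982Higgs1, (3.23) p.616] -/
theorem cumulantOf_nmoment_three (V : Ω → ℝ) :
    cumulantOf (nmoment V μ) 3
      = B1Sect3Statements.trunc3 (∫ ω, V ω ∂μ) (∫ ω, V ω ^ 2 ∂μ) (∫ ω, V ω ^ 3 ∂μ) := by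
  rw [cumulantOf_three _ (nmoment_zero V), nmoment_eq_integral, nmoment_eq_integral, nmoment_eq_integral,
    B1Sect3Statements.trunc3]
  simp only [pow_one]

/-- **(3.24) VERBATIM WITH PRINT'S (UNWEIGHTED) CUMULANTS ON THE RIGHT, `⟨χ e^V⟩ = exp[Σ_{n=1}^{n̄} κₙ(⟨V^·⟩)/n! + O(ε^κ)|T₁|]`**,
from leaf (a) `ha : |log⟨χ⟩| ≤ C₁ s^κ vol`, leaf (c) `hc : |f_χ⁽ⁿ̄⁺¹⁾| ≤ C₃ (n̄+1)! s^κ vol` on `[0,1]` (p27's shapes, the content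
of "the lemma on p. 152 of [2]", NOT derived) and the data of THIS file's leaf (b): `⟨χ⟩ ≥ ½`, `‖Vᵏ‖_{L²(μ)} ≤ M` (`k ≤ n̄`),
`⟨1 − χ⟩ ≤ a s^{2κ} vol`.  Conclusion: r12's carrier `Eq324 ⟨χe^V⟩ (cumulantOf (nmoment V μ)) n̄ (C₁ + leafBConst n̄ M·√a + C₃) s κ vol`
— p27's `eq324_chi` with its hypothesis `hb` DISCHARGED by `abs_sum_cumulantOf_sub_truncExp_le_pow`.
[cite: Balaban1982Higgs1, (3.24) p.616] -/
theorem eq324_chi_gaussianCumulants (hχm : Measurable χ) (hχ0 : ∀ ω, 0 ≤ χ ω) (hχ1 : ∀ ω, χ ω ≤ 1)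
    (hZ : 1 / 2 ≤ ∫ ω, χ ω ∂μ) (hVm : AEMeasurable V μ) (hVB : ∀ ω, χ ω ≠ 0 → |V ω| ≤ B) (nbar : ℕ)
    {M : ℝ} (hM : 1 ≤ M) (hV2 : ∀ k, 1 ≤ k → k ≤ nbar → MemLp (fun ω => V ω ^ k) 2 μ)
    (hVM : ∀ k, 1 ≤ k → k ≤ nbar → Real.sqrt (∫ ω, (V ω ^ k) ^ 2 ∂μ) ≤ M)
    {C₁ C₃ a s κ vol : ℝ} (ha0 : 0 ≤ a) (hs0 : 0 ≤ s) (hvol : 1 ≤ vol)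
    (hτ : ∫ ω, (1 - χ ω) ∂μ ≤ a * s ^ (2 * κ) * vol)
    (ha : |Real.log (∫ ω, χ ω ∂μ)| ≤ C₁ * s ^ κ * vol)
    (hc : ∀ t ∈ Set.Icc (0 : ℝ) 1,
      |iteratedDeriv (nbar + 1) (cgf V (chiMeasure μ χ)) t| ≤ C₃ * ((nbar + 1)! : ℝ) * s ^ κ * vol) :
    B1Sect3Statements.Eq324 (∫ ω, χ ω * Real.exp (V ω) ∂μ) (cumulantOf (nmoment V μ)) nbar
      (C₁ + leafBConst nbar M * Real.sqrt a + C₃) s κ vol :=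
  eq324_chi hχm hχ0 hχ1 (lt_of_lt_of_le (by norm_num) hZ) hVm hVB nbar _ ha
    (abs_sum_cumulantOf_sub_truncExp_le_pow hχm hχ0 hχ1 hZ hVm hVB nbar hM hV2 hVM ha0 hs0 hvol hτ) hc

end Knitting

/-! ## §6 The k-th step version (3.59): p27's `cumulant359_of_leaves` with leaf (b) discharged from moment data -/

section Family

open B1LowerBound (C359Setting Cumulant359)
open Literature.MathematicalPhysics.QuantumFieldTheory.Balaban1983to89.B1Eq324CumulantTaylor (Realization cumulant359_of_leaves)

/-- `leafBConst` is monotone in the truncation order. [cite: Balaban1982Higgs1, (3.59) p.623] -/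
theorem leafBConst_mono {n₁ n₂ : ℕ} (h : n₁ ≤ n₂) {M : ℝ} (hM : 0 ≤ M) : leafBConst n₁ M ≤ leafBConst n₂ M := by
  unfold leafBConst
  refine mul_le_mul_of_nonneg_left (Finset.sum_le_sum_of_subset_of_nonneg (Finset.Icc_subset_Icc_right h) ?_)
    (by positivity)
  intro n _ _
  exact div_nonneg (cumLip_nonneg n (by positivity)) (by positivity)

/-- **(3.59) FROM LEAVES (a), (c) AND MOMENT DATA, CONSTANTS UNIFORM IN THE RUN AND THE STEP.**  A measure-theoretic
realization `R` of a (3.59) family (p27's `B1Eq324CumulantTaylor.Realization`: Gaussian law `μ`, characteristic functions `χ`,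
polynomial `V^{(k)}` per run `j` and step `k`) whose carrier writes PRINT'S cumulants on the right
(`trunc k n = κₙ(⟨(V^{(k)})^·⟩_μ)`), with: `⟨χ⟩ ≥ ½`; `L²(μ)`-moment bounds `‖(V^{(k)})ⁱ‖₂ ≤ M₀·s^{−p}` (`s = (fam j).ell k =
L^kε ∈ (0,1]`, `M₀ ≥ 1`, `p ≥ 0`); tails `⟨1−χ⟩ ≤ a·s^{2(κ + p(n̄+1))}·|T₁^{(k)}|` (available for every exponent by leaf (a)'s
union bound); truncation orders `n̄ ≤ N`; and leaves (a) `|log⟨χ⟩| ≤ C₁ s^κ |T₁^{(k)}|`, (c) `|f_χ⁽ⁿ̄⁺¹⁾| ≤ C₃ (n̄+1)! s^κ |T₁^{(k)}|`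
as in p27's `cumulant359_of_leaves`.  Then r12's typed (3.59) `B1LowerBound.Cumulant359 fam` holds (constant
`C₁ + leafBConst N 1·M₀^{N+1}·√a + C₃`). [cite: Balaban1982Higgs1, (3.59) p.623] -/
theorem cumulant359_of_leaves_ac {J : Type} {fam : J → C359Setting} (R : Realization fam) {κ C₁ C₃ a M₀ p : ℝ} {N : ℕ}
    (hκ : ∀ j, ((fam j).d : ℝ) < κ) (hN : ∀ j, (fam j).nbar ≤ N)
    (htrunc : ∀ j k n, (fam j).trunc k n = cumulantOf (nmoment (R.V j k) (R.μ j k)) n)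
    (hZ : ∀ j k, 1 / 2 ≤ ∫ ω, R.χ j k ω ∂(R.μ j k))
    (hM₀ : 1 ≤ M₀) (hp : 0 ≤ p) (ha0 : 0 ≤ a)
    (hell : ∀ j k, 0 < (fam j).ell k) (hell1 : ∀ j k, (fam j).ell k ≤ 1) (hvol : ∀ j k, 1 ≤ (fam j).volK k)
    (hV2 : ∀ j k i, 1 ≤ i → i ≤ (fam j).nbar → MemLp (fun ω => R.V j k ω ^ i) 2 (R.μ j k))
    (hVM : ∀ j k i, 1 ≤ i → i ≤ (fam j).nbar →
      Real.sqrt (∫ ω, (R.V j k ω ^ i) ^ 2 ∂(R.μ j k)) ≤ M₀ * (fam j).ell k ^ (-p))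
    (hτ : ∀ j k, ∫ ω, (1 - R.χ j k ω) ∂(R.μ j k)
      ≤ a * (fam j).ell k ^ (2 * (κ + p * ((fam j).nbar + 1))) * (fam j).volK k)
    (ha : ∀ j k, |Real.log (∫ ω, R.χ j k ω ∂(R.μ j k))| ≤ C₁ * (fam j).ell k ^ κ * (fam j).volK k)
    (hc : ∀ j k, ∀ t ∈ Set.Icc (0 : ℝ) 1,
      |iteratedDeriv ((fam j).nbar + 1) (cgf (R.V j k) (chiMeasure (R.μ j k) (R.χ j k))) t|
        ≤ C₃ * (((fam j).nbar + 1)! : ℝ) * (fam j).ell k ^ κ * (fam j).volK k) :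
    Cumulant359 fam := by
  refine cumulant359_of_leaves R (C₂ := leafBConst N 1 * M₀ ^ (N + 1) * Real.sqrt a) hκ ha (fun j k => ?_) hc
  letI := R.mΩ j k
  haveI := R.prob j k
  have htr : (fam j).trunc k = cumulantOf (nmoment (R.V j k) (R.μ j k)) := funext (htrunc j k)
  set s := (fam j).ell k with hs
  have hs0 : 0 < s := hell j k
  have hMp : 1 ≤ M₀ * s ^ (-p) :=
    one_le_mul_of_one_le_of_one_le hM₀ (Real.one_le_rpow_of_pos_of_le_one_of_nonpos hs0 (hell1 j k) (by linarith))
  have h := abs_sum_cumulantOf_sub_truncExp_le_pow' (R.χ_meas j k) (R.χ_nonneg j k) (R.χ_le_one j k) (hZ j k)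
    (R.V_meas j k) (R.V_bd j k) (fam j).nbar hMp (hV2 j k) (hVM j k) ha0 hs0 (hvol j k) (hτ j k) le_rfl
  have hexp : κ + p * ((fam j).nbar + 1) - p * ((fam j).nbar + 1) = κ := by ring
  rw [hexp] at h
  rw [htr]
  refine h.trans (mul_le_mul_of_nonneg_right (mul_le_mul_of_nonneg_right (mul_le_mul_of_nonneg_right ?_
    (Real.sqrt_nonneg a)) (Real.rpow_nonneg hs0.le κ)) (zero_le_one.trans (hvol j k)))
  have h1 : leafBConst (fam j).nbar 1 ≤ leafBConst N 1 := leafBConst_mono (hN j) zero_le_one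
  have h2 : M₀ ^ ((fam j).nbar + 1) ≤ M₀ ^ (N + 1) := pow_le_pow_right₀ hM₀ (Nat.succ_le_succ (hN j))
  exact mul_le_mul h1 h2 (pow_nonneg (zero_le_one.trans hM₀) _) (leafBConst_nonneg N zero_le_one)

end Family

end

end Literature.MathematicalPhysics.QuantumFieldTheory.Balaban1983to89.B1Eq324WeightedCumulantLeaf
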